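import Summits.BirchSwinnertonDyer.BirchSwinnertonDyer.Theorems.SemiOrdinaryEisensteinDescentWildSplitEisensteinValueAtOneVVisibleOwnPoint412317d1
import Summits.BirchSwinnertonDyer.BirchSwinnertonDyer.Theorems.SemiOrdinaryEisensteinDescentWildSplitEisensteinValueAtOneVNonsplitKummerUnramified
import HarnessLib

/-!
# Route `SemiOrdinaryEisensteinDescent`, crux #2″ `WildSplitEisensteinValueAtOneV` (E_𝟙^V, stmt-BirchSwinnertonDyer-26610):
# the content row `412317d1` WITHOUT the Fisher 2016 Thm. 4.4 binder — `ord₃ #Ш(E)_an ≤ ord₃ #Ш(E)` modulo {CT, GZK} only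
# (cell `pub/bsd-wall`, width seat `bsd-wall-soed-p1-w3` g22; `--supports stmt-BirchSwinnertonDyer-26610`; THEOREMS ONLY; Theses-free)

WHY. The kernel record `VisibleOwnPoint412317d1.missingLowerBound_412317d1_of_visibleSha_ownPoint` (w3 g21, p649940) displays THREE
named facts: Cassels–Tate (`hCT`), GZK (`hGZK`) and Fisher 2016 Thm. 4.4 (`hF44`), the last one used ONLY at the place `2` of kind
(iv): `E = 412317d1` GOOD at `2`, the `3`-congruent partner `F = 274878a1` NON-SPLIT multiplicative at `2`, `2 ∤ 3`. That projection of
Theorem 4.4 is now a THEOREM of the tree (`NonsplitKummerUnramified.h1Equiv_mem_selmerLocalKer_of_hasGoodReductionAt_of_nonsplit`,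
this seat: the local Kummer condition at a non-split multiplicative `v ∤ p`, `p` odd, is unramified — twisted Tate uniformisation),
so the row is re-landed with the binder list {hCT, hGZK} of the other eight content rows. Everything else is the g21 record
verbatim (its per-place lemmas `kind_iv_E_F_at_2`, `T_div_at_3`, `kind_ii_E_F_at_15271`, `T_not_mem_range`, `T_div_at_139`,
`G0_not_div_at_139`, `irr_E_3` are consumed BY NAME).

RESULT FOR THE RUNG: all nine in-range content rows of E_𝟙^V are kernel theorems `MissingLowerBoundAt E 3` modulo EXACTLY
{hCT, hGZK} + Cremona's {r_an = 1, ord₃ #Ш_an ≤ 2}. HONEST FRAMING: ONE curve; conditional on the displayed published facts and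
data; BSD₃(E) is NOT claimed; the crux is NOT advanced class-wide; BSD is not proved by any of this.

References: [CremonaMazur2000] §3; [AgasheStein2002] L. 3.6; [Fisher2016Visualizing7] Thm. 4.4; [SilvermanATAEC1994] V.5; [Cremona2006].
-/

set_option autoImplicit false

noncomputable section

open scoped Classical

open WeierstrassCurve Literature.NumberTheory.EllipticCurves
  Literature.NumberTheory.EllipticCurves.Rank1Residual
  Literature.NumberTheory.EllipticCurves.Rank1Residual.Typed
  Literature.NumberTheory.EllipticCurves.Rank1Residual.X11RankOneCertificates
  Literature.NumberTheory.GaloisRepresentations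
  Summit.BirchSwinnertonDyer.BirchSwinnertonDyer.Rank1Residual.IntModel
  Summit.BirchSwinnertonDyer.Rank1Residual.X11b
  Summit.BirchSwinnertonDyer.Rank1Residual.GaloisImage
  Summit.BirchSwinnertonDyer.Rank1Residual.Supersingular
  Summit.BirchSwinnertonDyer.Rank1Residual.SecondDescent
open NumberField IsDedekindDomain Rat.HeightOneSpectrum Field
open Summit.BirchSwinnertonDyer.Rank1Residual.Supersingular.LocalOddTorsion

-- the Theorems namespace of this sub repeats the summit name by design (D-0017 nested layout)
set_option linter.dupNamespace false

namespace Summit.BirchSwinnertonDyer.BirchSwinnertonDyer.Theorems.VisibleOwnPoint412317d1FactFree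

open Summit.BirchSwinnertonDyer.Rank1Residual.Additive
open Summit.BirchSwinnertonDyer.BirchSwinnertonDyer.Theorems.VisibleOwnPoint
open Summit.BirchSwinnertonDyer.BirchSwinnertonDyer.Theorems.D1VisibleKernel
open Summit.BirchSwinnertonDyer.BirchSwinnertonDyer.Theorems.VisibleOwnPoint412317d1
open Summit.BirchSwinnertonDyer.BirchSwinnertonDyer.Theorems.NonsplitKummerUnramified

/-- **`ord₃ #Ш(E)_an ≤ ord₃ #Ш(E)` for `E = 412317d1` by ONE-WITNESS + OWN-POINT VISIBILITY from the `3`-congruent partner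
`F = 274878a1`, KERNEL RECORD WITHOUT the Fisher 2016 Thm. 4.4 binder.** Named facts: Cassels–Tate (`hCT`), GZK (`hGZK`) ONLY; the
place `2` of kind (iv) («`E` good, `F` non-split multiplicative», `2 ∤ 3`) is discharged by the tree theorem
`NonsplitKummerUnramified.h1Equiv_mem_selmerLocalKer_of_hasGoodReductionAt_of_nonsplit`. DISPLAYED per-pair data: the
`Γ_ℚ`-isomorphism `θ : F[3] ⥲ E[3]` (`θ`, `hθ`), Cremona's `r_an(E) = 1` (`hr1`) and `#Ш(E)_an = q` with `ord₃ q ≤ 2` (`hq`, `hv`;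
attested `q = 9`). Proof = the g21 record `missingLowerBound_412317d1_of_visibleSha_ownPoint` verbatim except at `v_2`. Per pair; NOT a class
theorem; BSD₃(E) is NOT claimed. [cite: CremonaMazur2000, §3 and Table 1] [cite: AgasheStein2002, Lemma 3.6]
[cite: Fisher2016Visualizing7, Thm. 4.4 (p. 106)] [cite: Cremona2006, Table 1 (Cremona labels 412317d1, 274878a1)] -/
theorem missingLowerBound_412317d1_of_visibleSha_ownPoint_factFree
    (hCT : exists_casselsTate_pairing (K := ℚ)) (hGZK : rank_eq_analyticRank_of_analyticRank_le_one)
    {W F : WeierstrassCurve ℚ} [W.IsElliptic] [W.IsGloballyMinimal] [F.IsElliptic] [F.IsGloballyMinimal]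
    (hWeq : W = ⟨0, 0, 1, -240, -1431⟩) (hFeq : F = ⟨1, -1, 0, -36, 1296⟩)
    (hr1 : W.analyticRank = 1) {q : ℚ} (hq : shaAn W = (q : ℂ)) (hv : padicValRat 3 q ≤ 2)
    (θ : geomTorsion F ((3 : ℕ) : ℤ) ≃+ geomTorsion W ((3 : ℕ) : ℤ))
    (hθ : ∀ (σ : Field.absoluteGaloisGroup ℚ) (P : geomTorsion F ((3 : ℕ) : ℤ)), θ (σ • P) = σ • θ P) :
    MissingLowerBoundAt W 3 := by
  haveI : Fact (Nat.Prime 3) := ⟨by norm_num⟩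
  have hn : ((3 : ℕ) : ℤ) ≠ 0 := by decide
  have hdiv' : ∀ P : geomPoints F, ∃ Q : geomPoints F, ((3 : ℕ) : ℤ) • Q = P := F.zsmul_geomPoints_surjective_holds hn
  have hT : F.toAffine.Nonsingular ((337032609726736 : ℚ) / 2472778265049) ((5900929915257462658868 : ℚ) / 3888461131237407843) := by
    rw [hFeq]; haveI := isElliptic_F
    exact WeierstrassCurve.Affine.equation_iff_nonsingular.mp ((WeierstrassCurve.Affine.equation_iff _ _).mpr (by norm_num))
  have hG : W.toAffine.Nonsingular ((-9 : ℚ)) (0 : ℚ) := by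
    rw [hWeq]; haveI := isElliptic_E
    exact WeierstrassCurve.Affine.equation_iff_nonsingular.mp ((WeierstrassCurve.Affine.equation_iff _ _).mpr (by norm_num))
  have hirr : Irr W 3 := by rw [hWeq]; exact irr_E_3
  -- the Kummer class of `T` is Selmer for `F` everywhere
  have hc : ∀ w : HeightOneSpectrum (𝓞 ℚ), kummerMapTorsion F ((3 : ℕ) : ℤ) hdiv' (.some _ _ hT) ∈
      selmerLocalKer F (w.adicCompletion ℚ) ((3 : ℕ) : ℤ) := fun w ↦ kummerMapTorsion_mem_selmerLocalKer F _ hdiv' _ _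
  -- the prime list: every prime divisor of Δ_E, Δ_F lies in L
  set L : List ℕ := [2, 3, 15271] with hL
  have hLp : ∀ r ∈ L, r.Prime := by
    intro r hr; simp only [hL, List.mem_cons, List.mem_nil_iff, or_false] at hr
    rcases hr with rfl | rfl | rfl <;> norm_num
  have hΔE : ∀ r : ℕ, r.Prime → (r : ℤ) ∣ (⟨0, 0, 1, -240, -1431⟩ : WeierstrassCurve ℤ).Δ → r ∈ L :=
    forall_mem_of_natAbs_eq_prod_pow L [0, 3, 1] hLp (by decide +kernel)
  have hΔF : ∀ r : ℕ, r.Prime → (r : ℤ) ∣ (⟨1, -1, 0, -36, 1296⟩ : WeierstrassCurve ℤ).Δ → r ∈ L :=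
    forall_mem_of_natAbs_eq_prod_pow L [6, 6, 1] hLp (by decide +kernel)
  -- the set of places S (over L)
  set e := primesEquiv (R := 𝓞 ℚ) with he
  set S : Finset (HeightOneSpectrum (𝓞 ℚ)) :=
    (L.filterMap fun r ↦ if h : r.Prime then some (e.symm ⟨r, h⟩) else none).toFinset with hSdef
  have hmemS : ∀ w : HeightOneSpectrum (𝓞 ℚ), w ∈ S ↔ (e w : ℕ) ∈ L := by
    intro w
    rw [hSdef, List.mem_toFinset, List.mem_filterMap]
    refine ⟨?_, fun hw ↦ ⟨(e w : ℕ), hw, by rw [dif_pos (e w).2]; simp⟩⟩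
    rintro ⟨r, hr, hrw⟩
    by_cases hrp : r.Prime
    · rw [dif_pos hrp, Option.some.injEq] at hrw; rw [← hrw, Equiv.apply_symm_apply]; exact hr
    · rw [dif_neg hrp] at hrw; exact absurd hrw (by simp)
  -- good reduction outside S
  have hS : ∀ w : HeightOneSpectrum (𝓞 ℚ), w ∉ S →
      W.HasGoodReductionAt w ∧ F.HasGoodReductionAt w ∧ (((3 : ℕ) : ℕ) : 𝓞 ℚ) ∉ w.asIdeal := by
    intro w hwS
    have hwL : (e w : ℕ) ∉ L := fun h ↦ hwS ((hmemS w).mpr h)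
    have hqp : (e w : ℕ).Prime := (e w).2
    refine ⟨?_, ?_, natCast_not_mem_of_primesEquiv_ne w Fact.out fun h ↦ hwL ?_⟩
    · rw [hWeq]; exact hasGoodReductionAt_mk_of_primesEquiv _ _ _ _ _ w rfl fun h ↦ hwL (hΔE _ hqp h)
    · rw [hFeq]; exact hasGoodReductionAt_mk_of_primesEquiv _ _ _ _ _ w rfl fun h ↦ hwL (hΔF _ hqp h)
    · show (primesEquiv w : ℕ) ∈ L
      rw [h]; decide
  -- the transported class is in the local condition of `E` at every place of `S`
  have hloc : ∀ w ∈ S, h1Equiv θ hθ (kummerMapTorsion F ((3 : ℕ) : ℤ) hdiv' (.some _ _ hT)) ∈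
      selmerLocalKer W (w.adicCompletion ℚ) ((3 : ℕ) : ℤ) := by
    intro w hwS
    have hwL : (e w : ℕ) ∈ L := (hmemS w).mp hwS
    have hcases : (e w : ℕ) = 2 ∨ (e w : ℕ) = 3 ∨ (e w : ℕ) = 15271 := by
      simp only [hL, List.mem_cons, List.mem_nil_iff, or_false] at hwL
      omega
    rcases hcases with hw | hw | hw
    · -- 2: kind (iv) «E good, F non-split multiplicative», `2 ∤ 3` — PROVED in the tree (this seat), no named fact
      obtain ⟨hWg, hFm, hFns⟩ := kind_iv_E_F_at_2 W F hWeq hFeq hw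
      exact h1Equiv_mem_selmerLocalKer_of_hasGoodReductionAt_of_nonsplit W w (by norm_num) F θ hθ
        (natCast_not_mem_of_primesEquiv_ne w Fact.out (by rw [hw]; decide)) hWg hFm hFns (hc w)
    · -- 3: option (a), formal group at level 2
      exact VisibleWitness.h1Equiv_kummerMapTorsion_mem_selmerLocalKer_of_exists_smul_eq W F θ hθ (w.adicCompletion ℚ) hn hdiv' _
        ((T_div_at_3 F hFeq hT hw).imp fun Q hQ ↦ by rw [natCast_zsmul]; exact hQ)
    · -- 15271: kind (ii), Tate uniformisation PROVED in the tree
      obtain ⟨hWs, hFs, hcard⟩ := kind_ii_E_F_at_15271 W F hWeq hFeq hw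
      exact W.h1Equiv_mem_selmerLocalKer_of_hasSplitMultiplicativeReductionAt w
        TateCurve.Silverman1994_thmV53_tateUniformisation_holds F θ hθ hWs hFs hcard (hc w)
  -- the separating place `v_139`
  have hsep : ∃ w : HeightOneSpectrum (𝓞 ℚ), (e w : ℕ) = 139 := ⟨e.symm ⟨139, by norm_num⟩, by rw [Equiv.apply_symm_apply]⟩
  obtain ⟨v₁, hv1⟩ := hsep
  exact missingLowerBoundAt_rankOne_irr_of_witness_of_ownPoint hCT hGZK (by norm_num) hirr hr1 hq hv F θ hθ S hS hdiv'
    (.some _ _ hT) (T_not_mem_range F hFeq hT) hloc v₁ (T_div_at_139 F hFeq hT hv1) (.some _ _ hG)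
    (G0_not_div_at_139 W hWeq hG hv1)

end Summit.BirchSwinnertonDyer.BirchSwinnertonDyer.Theorems.VisibleOwnPoint412317d1FactFree

end
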